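import Mathlib.Topology.MetricSpace.ProperSpace
import Literature.Geometry.Lorentzian.Basic
import Literature.Geometry.Lorentzian.CoordScalarCurvatureEvolution
import Summits.FinalStateConjecture.FinalStateConjecture.Theorems.BartnikGapSettlingGapExhaustionFinslerLemma
import Summits.FinalStateConjecture.FinalStateConjecture.Theorems.BartnikGapSettlingGapExhaustionConditionalMarginMultiplier
import HarnessLib

/-!
# Crux `GapExhaustion` (stmt-FinalStateConjecture-10808), line `photon-shell-pseudoconvexity`:
# stub (UP-1) `stub_multiplierFormStableParam` — the uniform, `C¹`-stable multiplier form of a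
# constrained Hessian margin, UNIFORMLY over a compact set of LABELLED base points

Route `BartnikGapSettling`; helper (`--supports stmt-FinalStateConjecture-10808`) landing the
registered sub-stub (UP-1) of line lead c11 (label-uniformity wave 1). It is the PARAMETRIC twin of
the per-label brick `stub_multiplierFormStable`
(`BartnikGapSettlingGapExhaustionMultiplierFormStable.lean`): the reference components `G₀ p` and
the reference function `f p` now depend on a label `p : ℝ × ℝ` (the Kerr label `(M, a)`), jointly
smoothly in `(p, x)`, and the base points `q = (p, x)` range over a compact set
`S ⊆ (ℝ × ℝ) × E4` of labelled points. Hypothesis: a MARGIN `Hess f(w,w) ≤ −m‖w‖²` on the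
constrained cone `{G₀ p x w w = 0, d(f p)_x(w) = 0, G₀ p x e w = 0}` at every `q = (p, x) ∈ S`.
Conclusion: the QUANTITATIVE condition (po3) of Ionescu–Klainerman (Invent. Math. 175 (2009),
Definition 3.1) — ONE `ε₁ > 0` and, at each labelled point and for each `δ`-perturbation
`(G x, DG(x), e')` of the `1`-jet of the components at the point and of the conditioning vector, a
multiplier `μ ∈ [−ε₁⁻¹, ε₁⁻¹]` with
`ε₁²‖w‖² ≤ μ G x w w − Hess_G (f p)(x)(w,w) + ε₁⁻²((G x e' w)² + (d(f p)_x w)²)` for ALL `w` —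
with `δ, ε₁` uniform over `S`, which is the form the label-uniform near-Kerr sweep consumes.

Proof. The (po3) conclusion at a point only involves the POINT DATA
`d = (G x, d(f p)_x, Hess_G (f p)(x), e') ∈ (E4 →L[ℝ] E4 →L[ℝ] ℝ) × (E4 →L[ℝ] ℝ) × (E4 →L[ℝ] E4 →L[ℝ] ℝ) × E4` (bilinear forms, a linear form, a
vector), and the margin hypothesis only the reference data `d₀(q)`. Step (A), pure linear algebra
(`stub_multiplierFormStableParam_jet`): a margin at `d₀` gives `δ, ε₁ > 0` such that (po3) holds
at every `d` with `dist d d₀ < δ` — pointwise by Finsler's lemma with margin (F-1,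
`stub_finslerLemma`) and its doubly constrained form (F-2, `stub_conditionalMarginMultiplier`),
then continuity of the frozen-constant functional, compactness of the unit sphere
(`IsCompact.eventually_forall_of_forall_eventually`) and `2`-homogeneity. Step (B): the coordinate
Hessian `hessAt G f x` is a continuous function of the jet `(G x, DG(x), df_x, D²f(x))` wherever
`G x` is invertible (inversion of continuous linear maps is continuous there), and the reference
jet `q ↦ (G₀ q.1 q.2, D(G₀ q.1)(q.2), D(f q.1)(q.2), D²(f q.1)(q.2))` is continuous at the points
of the open set of joint smoothness (parametric differentiation, Mathlib's `ContDiffAt.fderiv`).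
Hence near each `q ∈ S` a `δ`-perturbed jet at `q'` has point data close to `d₀(q)`, and (A)
applies with the constants of `q`; an induction over the compact `S` (`IsCompact.induction_on`,
the conclusion being monotone under shrinking `δ`, `ε₁`) makes `δ, ε₁` uniform.
-/

noncomputable section

-- instance search through the nested operator types `E4 →L[ℝ] E4 →L[ℝ] E4 →L[ℝ] ℝ`
set_option maxSynthPendingDepth 3

-- D-0017: single-problem summit, `Summit.<S>.<S>.…` by design (cf. lakefile `weak.linter.dupNamespace`).
set_option linter.dupNamespace false

namespace Summit.FinalStateConjecture.FinalStateConjecture.Theorems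

open Set Filter
open Literature.Geometry.Lorentzian Literature.Geometry.Lorentzian.MetricCoord
open scoped Topology ContDiff

/-- The (po3) conclusion for point data `(g, ℓ, H, e')` is monotone under shrinking `ε₁` (the
multiplier range and the penalty grow, the demanded margin shrinks). [folklore] -/
private theorem stub_multiplierFormStableParam_mono {g H : (E4 →L[ℝ] E4 →L[ℝ] ℝ)} {ℓ : (E4 →L[ℝ] ℝ)} {e' : E4} {ε₁ ε₁' : ℝ}
    (h : ∃ μ : ℝ, |μ| ≤ ε₁⁻¹ ∧ ∀ w : E4,
      ε₁ ^ 2 * ‖w‖ ^ 2 ≤ μ * g w w - H w w + ε₁⁻¹ ^ 2 * ((g e' w) ^ 2 + (ℓ w) ^ 2))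
    (hε' : 0 < ε₁') (hle : ε₁' ≤ ε₁) :
    ∃ μ : ℝ, |μ| ≤ ε₁'⁻¹ ∧ ∀ w : E4,
      ε₁' ^ 2 * ‖w‖ ^ 2 ≤ μ * g w w - H w w + ε₁'⁻¹ ^ 2 * ((g e' w) ^ 2 + (ℓ w) ^ 2) := by
  obtain ⟨μ, hμ, hall⟩ := h
  have hε : 0 < ε₁ := hε'.trans_le hle
  have hinv : ε₁⁻¹ ≤ ε₁'⁻¹ := by
    rw [inv_le_inv₀ hε hε']
    exact hle
  refine ⟨μ, hμ.trans hinv, fun w => ?_⟩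
  have h1 : ε₁' ^ 2 * ‖w‖ ^ 2 ≤ ε₁ ^ 2 * ‖w‖ ^ 2 :=
    mul_le_mul_of_nonneg_right (pow_le_pow_left₀ hε'.le hle 2) (sq_nonneg _)
  have h2 : ε₁⁻¹ ^ 2 * ((g e' w) ^ 2 + (ℓ w) ^ 2) ≤ ε₁'⁻¹ ^ 2 * ((g e' w) ^ 2 + (ℓ w) ^ 2) :=
    mul_le_mul_of_nonneg_right (pow_le_pow_left₀ (inv_nonneg.2 hε.le) hinv 2) (by positivity)
  linarith [hall w]

/-- Homogeneity reduction: a degree-`2` homogeneous real function on `E4` that is nonpositive on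
unit vectors is nonpositive everywhere. [folklore] -/
private theorem stub_multiplierFormStableParam_nonpos (Φ : E4 → ℝ)
    (hΦ : ∀ (r : ℝ) (x : E4), Φ (r • x) = r ^ 2 * Φ x) (h : ∀ u : E4, ‖u‖ = 1 → Φ u ≤ 0)
    (x : E4) : Φ x ≤ 0 := by
  by_cases hx : x = 0
  · have h0 := hΦ 0 0
    rw [zero_smul] at h0
    rw [hx, h0]
    simp
  · have hr : 0 < ‖x‖ := norm_pos_iff.2 hx
    have hu : ‖‖x‖⁻¹ • x‖ = 1 := by
      rw [norm_smul, norm_inv, norm_norm, inv_mul_cancel₀ hr.ne']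
    have hxu : x = ‖x‖ • (‖x‖⁻¹ • x) := by
      rw [smul_smul, mul_inv_cancel₀ hr.ne', one_smul]
    rw [hxu, hΦ]
    exact mul_nonpos_of_nonneg_of_nonpos (sq_nonneg _) (h _ hu)

/-- **Step (A): the stable multiplier form of a constrained margin, for point data.** If the
bilinear form `H₀` has the margin `H₀ w w ≤ −m‖w‖²` (`m > 0`) on the constrained cone
`{g₀ w w = 0, ℓ₀ w = 0, g₀ e w = 0}`, then there are `δ, ε₁ > 0` such that for ALL point data
`d = (g, ℓ, H, e')` within `δ` of `(g₀, ℓ₀, H₀, e)` there is `μ ∈ [−ε₁⁻¹, ε₁⁻¹]` with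
`ε₁²‖w‖² ≤ μ g w w − H w w + ε₁⁻²((g e' w)² + (ℓ w)²)` for all `w` — condition (po3) of
Ionescu–Klainerman, Invent. Math. 175 (2009), Definition 3.1. Pointwise by Finsler's lemma with
margin (F-1) and its doubly constrained form (F-2); stable by continuity of the frozen-constant
functional, compactness of the unit sphere and `2`-homogeneity. [folklore] -/
theorem stub_multiplierFormStableParam_jet (g₀ H₀ : (E4 →L[ℝ] E4 →L[ℝ] ℝ)) (ℓ₀ : (E4 →L[ℝ] ℝ)) (e : E4) {m : ℝ} (hm : 0 < m)
    (hq : ∀ w : E4, g₀ w w = 0 → ℓ₀ w = 0 → g₀ e w = 0 → H₀ w w ≤ -m * ‖w‖ ^ 2) :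
    ∃ (δ ε₁ : ℝ), 0 < δ ∧ 0 < ε₁ ∧ ∀ d : (E4 →L[ℝ] E4 →L[ℝ] ℝ) × (E4 →L[ℝ] ℝ) × (E4 →L[ℝ] E4 →L[ℝ] ℝ) × E4, dist d (g₀, ℓ₀, H₀, e) < δ →
      ∃ μ : ℝ, |μ| ≤ ε₁⁻¹ ∧ ∀ w : E4,
        ε₁ ^ 2 * ‖w‖ ^ 2 ≤ μ * d.1 w w - d.2.2.1 w w
          + ε₁⁻¹ ^ 2 * ((d.1 d.2.2.2 w) ^ 2 + (d.2.1 w) ^ 2) := by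
  -- Step 1: pointwise multiplier form at the reference data (F-1 + F-2), penalty constant `≥ 0`
  obtain ⟨μ, C', c, hc, hpt'⟩ :=
    stub_conditionalMarginMultiplier stub_finslerLemma H₀ g₀ ℓ₀ (g₀ e) m hm hq
  obtain ⟨C, hC0, hpt⟩ : ∃ C : ℝ, 0 ≤ C ∧
      ∀ w : E4, H₀ w w - μ * g₀ w w - C * ((ℓ₀ w) ^ 2 + (g₀ e w) ^ 2) ≤ -c * ‖w‖ ^ 2 := by
    refine ⟨max C' 0, le_max_right _ _, fun w => ?_⟩
    have hpen : 0 ≤ (ℓ₀ w) ^ 2 + (g₀ e w) ^ 2 := by positivity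
    have := hpt' w
    nlinarith [le_max_left C' 0, hpen]
  -- Step 2: the frozen-constant functional is `< -c/2` on the unit sphere near the reference data
  have hF : Continuous fun z : ((E4 →L[ℝ] E4 →L[ℝ] ℝ) × (E4 →L[ℝ] ℝ) × (E4 →L[ℝ] E4 →L[ℝ] ℝ) × E4) × E4 =>
      z.1.2.2.1 z.2 z.2 - μ * z.1.1 z.2 z.2
        - C * ((z.1.2.1 z.2) ^ 2 + (z.1.1 z.1.2.2.2 z.2) ^ 2) := by
    fun_prop
  have hnear : ∀ᶠ d : (E4 →L[ℝ] E4 →L[ℝ] ℝ) × (E4 →L[ℝ] ℝ) × (E4 →L[ℝ] E4 →L[ℝ] ℝ) × E4 in 𝓝 (g₀, ℓ₀, H₀, e), ∀ v ∈ Metric.sphere (0 : E4) 1,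
      d.2.2.1 v v - μ * d.1 v v - C * ((d.2.1 v) ^ 2 + (d.1 d.2.2.2 v) ^ 2) < -(c / 2) := by
    refine (isCompact_sphere (0 : E4) 1).eventually_forall_of_forall_eventually
      (P := fun (d : (E4 →L[ℝ] E4 →L[ℝ] ℝ) × (E4 →L[ℝ] ℝ) × (E4 →L[ℝ] E4 →L[ℝ] ℝ) × E4) (v : E4) =>
        d.2.2.1 v v - μ * d.1 v v - C * ((d.2.1 v) ^ 2 + (d.1 d.2.2.2 v) ^ 2) < -(c / 2))
      fun v hv => ?_
    have hv1 : ‖v‖ = 1 := mem_sphere_zero_iff_norm.1 hv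
    refine (hF.continuousAt (x := ((g₀, ℓ₀, H₀, e), v))).eventually_lt continuousAt_const ?_
    have h := hpt v
    rw [hv1] at h
    dsimp only
    linarith
  obtain ⟨r, hr, hrball⟩ := Metric.eventually_nhds_iff.1 hnear
  -- Step 3: the constants
  set ε₁ : ℝ := min (1 / 2) (min (c / 2) (|μ| + C + 1)⁻¹) with hε₁def
  have hK : 0 < |μ| + C + 1 := by
    have := abs_nonneg μ
    linarith
  have hε₁pos : 0 < ε₁ := lt_min (by norm_num) (lt_min (half_pos hc) (inv_pos.2 hK))
  have hε₁half : ε₁ ≤ 1 / 2 := min_le_left _ _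
  have hε₁c : ε₁ ≤ c / 2 := (min_le_right _ _).trans (min_le_left _ _)
  have hε₁K : ε₁ ≤ (|μ| + C + 1)⁻¹ := (min_le_right _ _).trans (min_le_right _ _)
  have hinvK : |μ| + C + 1 ≤ ε₁⁻¹ := by
    rw [le_inv_comm₀ hK hε₁pos]
    exact hε₁K
  have hsq : ε₁ ^ 2 ≤ c / 2 := by nlinarith
  have hμb : |μ| ≤ ε₁⁻¹ := by linarith [abs_nonneg μ]
  have hCb : C ≤ ε₁⁻¹ ^ 2 := by nlinarith [abs_nonneg μ]
  refine ⟨r, ε₁, hr, hε₁pos, fun d hd => ⟨μ, hμb, fun w => ?_⟩⟩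
  have hgood := hrball hd
  -- Step 4: homogeneity
  have key := stub_multiplierFormStableParam_nonpos
    (fun w => d.2.2.1 w w - μ * d.1 w w - C * ((d.2.1 w) ^ 2 + (d.1 d.2.2.2 w) ^ 2)
      + c / 2 * ‖w‖ ^ 2) ?_ ?_ w
  · have hpen : 0 ≤ (d.1 d.2.2.2 w) ^ 2 + (d.2.1 w) ^ 2 := by positivity
    have h1 : C * ((d.2.1 w) ^ 2 + (d.1 d.2.2.2 w) ^ 2) ≤
        ε₁⁻¹ ^ 2 * ((d.1 d.2.2.2 w) ^ 2 + (d.2.1 w) ^ 2) := by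
      rw [add_comm ((d.2.1 w) ^ 2)]
      exact mul_le_mul_of_nonneg_right hCb hpen
    have h2 : ε₁ ^ 2 * ‖w‖ ^ 2 ≤ c / 2 * ‖w‖ ^ 2 := mul_le_mul_of_nonneg_right hsq (sq_nonneg _)
    linarith
  · intro ρ y
    simp only [map_smul, smul_apply, smul_eq_mul, norm_smul, Real.norm_eq_abs, mul_pow, sq_abs]
    ring
  · intro u hu
    have h := hgood u (mem_sphere_zero_iff_norm.2 hu)
    simp only [hu, one_pow, mul_one]
    linarith

/-- **Step (B1): the coordinate Hessian is a continuous function of the jet.** The map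
`(g, Γ, ℓ, h) ↦ h − ℓ ∘ (½ g⁻¹ 𝒦(Γ))` (`𝒦` the Koszul operator), whose value on the jet
`(G x, DG(x), df_x, D²f(x))` is `hessAt G f x`, is continuous at every jet with `g` invertible
(inversion of continuous linear maps is smooth at invertible maps). [folklore] -/
theorem stub_multiplierFormStableParam_continuousAt_hessJet {j₀ : (E4 →L[ℝ] E4 →L[ℝ] ℝ) × (E4 →L[ℝ] E4 →L[ℝ] E4 →L[ℝ] ℝ) × (E4 →L[ℝ] ℝ) × (E4 →L[ℝ] E4 →L[ℝ] ℝ)}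
    (hi : j₀.1.IsInvertible) :
    ContinuousAt (fun j : (E4 →L[ℝ] E4 →L[ℝ] ℝ) × (E4 →L[ℝ] E4 →L[ℝ] E4 →L[ℝ] ℝ) × (E4 →L[ℝ] ℝ) × (E4 →L[ℝ] E4 →L[ℝ] ℝ) => j.2.2.2 -
      (ContinuousLinearMap.compL ℝ E4 E4 ℝ j.2.2.1).comp ((2⁻¹ : ℝ) •
        ((ContinuousLinearMap.compL ℝ E4 (E4 →L[ℝ] ℝ) E4 j.1.inverse).comp (koszulOp j.2.1)))) j₀ := by
  have h1 : ContinuousAt (fun j : (E4 →L[ℝ] E4 →L[ℝ] ℝ) × (E4 →L[ℝ] E4 →L[ℝ] E4 →L[ℝ] ℝ) × (E4 →L[ℝ] ℝ) × (E4 →L[ℝ] E4 →L[ℝ] ℝ) => j.1.inverse) j₀ :=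
    (hi.contDiffAt_map_inverse (n := 0)).continuousAt.comp continuousAt_fst
  have h2 : ContinuousAt
      (fun j : (E4 →L[ℝ] E4 →L[ℝ] ℝ) × (E4 →L[ℝ] E4 →L[ℝ] E4 →L[ℝ] ℝ) × (E4 →L[ℝ] ℝ) × (E4 →L[ℝ] E4 →L[ℝ] ℝ) => ContinuousLinearMap.compL ℝ E4 (E4 →L[ℝ] ℝ) E4 j.1.inverse) j₀ :=
    (ContinuousLinearMap.continuous _).continuousAt.comp h1
  have h3 : Continuous fun j : (E4 →L[ℝ] E4 →L[ℝ] ℝ) × (E4 →L[ℝ] E4 →L[ℝ] E4 →L[ℝ] ℝ) × (E4 →L[ℝ] ℝ) × (E4 →L[ℝ] E4 →L[ℝ] ℝ) => koszulOp j.2.1 :=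
    koszulOp.continuous.comp (continuous_fst.comp continuous_snd)
  have h4 : Continuous fun j : (E4 →L[ℝ] E4 →L[ℝ] ℝ) × (E4 →L[ℝ] E4 →L[ℝ] E4 →L[ℝ] ℝ) × (E4 →L[ℝ] ℝ) × (E4 →L[ℝ] E4 →L[ℝ] ℝ) => ContinuousLinearMap.compL ℝ E4 E4 ℝ j.2.2.1 :=
    (ContinuousLinearMap.continuous _).comp (continuous_fst.comp (continuous_snd.comp continuous_snd))
  have h5 : Continuous fun j : (E4 →L[ℝ] E4 →L[ℝ] ℝ) × (E4 →L[ℝ] E4 →L[ℝ] E4 →L[ℝ] ℝ) × (E4 →L[ℝ] ℝ) × (E4 →L[ℝ] E4 →L[ℝ] ℝ) => j.2.2.2 :=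
    continuous_snd.comp (continuous_snd.comp continuous_snd)
  exact h5.continuousAt.sub
    (h4.continuousAt.clm_comp ((h2.clm_comp h3.continuousAt).const_smul (2⁻¹ : ℝ)))

/-- **Step (B2): differentiation in the point, with the label as a parameter.** If
`(p, x) ↦ φ p x` is `C^∞` on an open set `U ⊆ (ℝ × ℝ) × E4`, then so is the partial derivative
in the point, `(p, x) ↦ D(φ p)(x)` (Mathlib's `ContDiffAt.fderiv`; Dieudonné 1960, (8.12.6)).
[folklore] -/
theorem stub_multiplierFormStableParam_contDiffOn_fderiv {F : Type*} [NormedAddCommGroup F]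
    [NormedSpace ℝ F] {φ : ℝ × ℝ → E4 → F} {U : Set ((ℝ × ℝ) × E4)} (hU : IsOpen U)
    (hφ : ContDiffOn ℝ ∞ (fun q : (ℝ × ℝ) × E4 => φ q.1 q.2) U) :
    ContDiffOn ℝ ∞ (fun q : (ℝ × ℝ) × E4 => fderiv ℝ (φ q.1) q.2) U := by
  intro q hq
  have hunc : ContDiffAt ℝ ∞ (Function.uncurry fun (q : (ℝ × ℝ) × E4) (y : E4) => φ q.1 y)
      (q, q.2) := by
    have e : (Function.uncurry fun (q : (ℝ × ℝ) × E4) (y : E4) => φ q.1 y) =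
        (fun q : (ℝ × ℝ) × E4 => φ q.1 q.2) ∘ fun r : ((ℝ × ℝ) × E4) × E4 => (r.1.1, r.2) := by
      funext r
      rfl
    rw [e]
    exact (hφ.contDiffAt (hU.mem_nhds hq)).comp (q, q.2)
      ((contDiff_fst.comp contDiff_fst).prodMk contDiff_snd).contDiffAt
  exact (hunc.fderiv contDiffAt_snd (le_of_eq ENat.coe_top_add_one)).contDiffWithinAt

/-- **Step (B3): the reference jet is continuous.** For `G₀`, `f` jointly `C^∞` in `(p, x)` on the
open `U`, the reference jet `q ↦ (G₀ q.1 q.2, D(G₀ q.1)(q.2), D(f q.1)(q.2), D²(f q.1)(q.2))` is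
continuous at every `q ∈ U`. [folklore] -/
theorem stub_multiplierFormStableParam_continuousAt_jet
    {G₀ : ℝ × ℝ → E4 → (E4 →L[ℝ] E4 →L[ℝ] ℝ)} {f : ℝ × ℝ → E4 → ℝ} {U : Set ((ℝ × ℝ) × E4)} (hU : IsOpen U)
    (hG₀ : ContDiffOn ℝ ∞ (fun q : (ℝ × ℝ) × E4 => G₀ q.1 q.2) U)
    (hf : ContDiffOn ℝ ∞ (fun q : (ℝ × ℝ) × E4 => f q.1 q.2) U) {q : (ℝ × ℝ) × E4} (hq : q ∈ U) :
    ContinuousAt (fun q' : (ℝ × ℝ) × E4 => ((G₀ q'.1 q'.2, fderiv ℝ (G₀ q'.1) q'.2,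
      fderiv ℝ (f q'.1) q'.2, fderiv ℝ (fderiv ℝ (f q'.1)) q'.2) : (E4 →L[ℝ] E4 →L[ℝ] ℝ) × (E4 →L[ℝ] E4 →L[ℝ] E4 →L[ℝ] ℝ) × (E4 →L[ℝ] ℝ) × (E4 →L[ℝ] E4 →L[ℝ] ℝ))) q := by
  have hqU : U ∈ 𝓝 q := hU.mem_nhds hq
  have h1 : ContinuousAt (fun q' : (ℝ × ℝ) × E4 => G₀ q'.1 q'.2) q :=
    hG₀.continuousOn.continuousAt hqU
  have h2 : ContinuousAt (fun q' : (ℝ × ℝ) × E4 => fderiv ℝ (G₀ q'.1) q'.2) q :=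
    (stub_multiplierFormStableParam_contDiffOn_fderiv hU hG₀).continuousOn.continuousAt hqU
  have hf₁ : ContDiffOn ℝ ∞ (fun q' : (ℝ × ℝ) × E4 => fderiv ℝ (f q'.1) q'.2) U :=
    stub_multiplierFormStableParam_contDiffOn_fderiv hU hf
  have h3 : ContinuousAt (fun q' : (ℝ × ℝ) × E4 => fderiv ℝ (f q'.1) q'.2) q :=
    hf₁.continuousOn.continuousAt hqU
  have h4 : ContinuousAt (fun q' : (ℝ × ℝ) × E4 => fderiv ℝ (fderiv ℝ (f q'.1)) q'.2) q :=
    (stub_multiplierFormStableParam_contDiffOn_fderiv (φ := fun p => fderiv ℝ (f p)) hU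
      hf₁).continuousOn.continuousAt hqU
  exact h1.prodMk (h2.prodMk (h3.prodMk h4))

/-- **Local step of (UP-1).** Near every point `q` of the open set `U` of joint smoothness at which
`G₀ q.1 q.2` is invertible and the constrained margin holds, there are a neighbourhood `t` of `q`
and `δ, ε₁ > 0` such that the (po3) conclusion holds at every `q' ∈ t` for all `δ`-perturbed jets
and conditioning vectors: by (B1)–(B3) the perturbed point data at `q'` is close to the reference
point data at `q`, and (A) applies with the constants of `q`. [folklore] -/
private theorem stub_multiplierFormStableParam_local
    {G₀ : ℝ × ℝ → E4 → (E4 →L[ℝ] E4 →L[ℝ] ℝ)} {f : ℝ × ℝ → E4 → ℝ} {e : E4} {U : Set ((ℝ × ℝ) × E4)} {m : ℝ}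
    (hU : IsOpen U) (hG₀ : ContDiffOn ℝ ∞ (fun q : (ℝ × ℝ) × E4 => G₀ q.1 q.2) U)
    (hf : ContDiffOn ℝ ∞ (fun q : (ℝ × ℝ) × E4 => f q.1 q.2) U) (hm : 0 < m)
    {q : (ℝ × ℝ) × E4} (hq : q ∈ U) (hi : (G₀ q.1 q.2).IsInvertible)
    (hmq : ∀ w : E4, G₀ q.1 q.2 w w = 0 → fderiv ℝ (f q.1) q.2 w = 0 → G₀ q.1 q.2 e w = 0 →
      hessAt (G₀ q.1) (f q.1) q.2 w w ≤ -m * ‖w‖ ^ 2) :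
    ∃ t ∈ 𝓝 q, ∃ (δ ε₁ : ℝ), 0 < δ ∧ 0 < ε₁ ∧ ∀ q' ∈ t,
      ∀ (G : E4 → (E4 →L[ℝ] E4 →L[ℝ] ℝ)) (e' : E4),
        ‖G q'.2 - G₀ q'.1 q'.2‖ ≤ δ → ‖fderiv ℝ G q'.2 - fderiv ℝ (G₀ q'.1) q'.2‖ ≤ δ →
        ‖e' - e‖ ≤ δ →
        ∃ μ : ℝ, |μ| ≤ ε₁⁻¹ ∧ ∀ w : E4,
          ε₁ ^ 2 * ‖w‖ ^ 2 ≤ μ * G q'.2 w w - hessAt G (f q'.1) q'.2 w w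
            + ε₁⁻¹ ^ 2 * ((G q'.2 e' w) ^ 2 + (fderiv ℝ (f q'.1) q'.2 w) ^ 2) := by
  -- (A) at the reference point data of `q`
  obtain ⟨δA, ε₁, hδA, hε₁, hA⟩ := stub_multiplierFormStableParam_jet (G₀ q.1 q.2)
    (hessAt (G₀ q.1) (f q.1) q.2) (fderiv ℝ (f q.1) q.2) e hm hmq
  -- (B) the jets: reference jet `J`, Hessian-of-jet map `Ψ`
  set J : (ℝ × ℝ) × E4 → (E4 →L[ℝ] E4 →L[ℝ] ℝ) × (E4 →L[ℝ] E4 →L[ℝ] E4 →L[ℝ] ℝ) × (E4 →L[ℝ] ℝ) × (E4 →L[ℝ] E4 →L[ℝ] ℝ) := fun q' => (G₀ q'.1 q'.2, fderiv ℝ (G₀ q'.1) q'.2,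
    fderiv ℝ (f q'.1) q'.2, fderiv ℝ (fderiv ℝ (f q'.1)) q'.2) with hJdef
  set Ψ : (E4 →L[ℝ] E4 →L[ℝ] ℝ) × (E4 →L[ℝ] E4 →L[ℝ] E4 →L[ℝ] ℝ) × (E4 →L[ℝ] ℝ) × (E4 →L[ℝ] E4 →L[ℝ] ℝ) → (E4 →L[ℝ] E4 →L[ℝ] ℝ) := fun j => j.2.2.2 -
    (ContinuousLinearMap.compL ℝ E4 E4 ℝ j.2.2.1).comp ((2⁻¹ : ℝ) •
      ((ContinuousLinearMap.compL ℝ E4 (E4 →L[ℝ] ℝ) E4 j.1.inverse).comp (koszulOp j.2.1)))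
    with hΨdef
  have hΨ : ContinuousAt Ψ (J q) :=
    stub_multiplierFormStableParam_continuousAt_hessJet (j₀ := J q) hi
  obtain ⟨ρ, hρ, hΨρ⟩ := Metric.continuousAt_iff.1 hΨ δA hδA
  have hJ : ContinuousAt J q := stub_multiplierFormStableParam_continuousAt_jet hU hG₀ hf hq
  set δ : ℝ := min ρ δA / 2 with hδdef
  have hδ : 0 < δ := half_pos (lt_min hρ hδA)
  have hδρ : δ + δ ≤ ρ := by rw [hδdef, add_halves]; exact min_le_left _ _
  have hδA' : δ + δ ≤ δA := by rw [hδdef, add_halves]; exact min_le_right _ _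
  have ht : ∀ᶠ q' in 𝓝 q, dist (J q') (J q) < δ := Metric.tendsto_nhds.1 hJ δ hδ
  refine ⟨{q' | dist (J q') (J q) < δ}, ht, δ, ε₁, hδ, hε₁, fun q' hq' G e' hG hdG he => ?_⟩
  have hq'c : dist (J q') (J q) < δ := hq'
  have hcomp := hq'c
  rw [hJdef] at hcomp
  simp only [Prod.dist_eq, max_lt_iff] at hcomp
  obtain ⟨hc1, -, hc3, -⟩ := hcomp
  -- the Hessian of the perturbed jet at `q'` is `δA`-close to the reference Hessian at `q`
  have hH : dist (hessAt G (f q'.1) q'.2) (hessAt (G₀ q.1) (f q.1) q.2) < δA := by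
    have e1 : hessAt G (f q'.1) q'.2 =
        Ψ (G q'.2, fderiv ℝ G q'.2, fderiv ℝ (f q'.1) q'.2, fderiv ℝ (fderiv ℝ (f q'.1)) q'.2) :=
      rfl
    have e2 : hessAt (G₀ q.1) (f q.1) q.2 = Ψ (J q) := rfl
    rw [e1, e2]
    apply hΨρ
    have hnear : dist ((G q'.2, fderiv ℝ G q'.2, fderiv ℝ (f q'.1) q'.2,
        fderiv ℝ (fderiv ℝ (f q'.1)) q'.2) : (E4 →L[ℝ] E4 →L[ℝ] ℝ) × (E4 →L[ℝ] E4 →L[ℝ] E4 →L[ℝ] ℝ) × (E4 →L[ℝ] ℝ) × (E4 →L[ℝ] E4 →L[ℝ] ℝ)) (J q') ≤ δ := by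
      rw [hJdef]
      simp only [Prod.dist_eq, dist_self]
      rw [dist_eq_norm, dist_eq_norm]
      exact max_le hG (max_le hdG hδ.le)
    calc dist _ (J q) ≤ dist _ (J q') + dist (J q') (J q) := dist_triangle _ _ _
      _ < δ + δ := add_lt_add_of_le_of_lt hnear hq'c
      _ ≤ ρ := hδρ
  -- the perturbed point data at `q'` is `δA`-close to the reference point data at `q`
  have hd : dist ((G q'.2, fderiv ℝ (f q'.1) q'.2, hessAt G (f q'.1) q'.2, e') : (E4 →L[ℝ] E4 →L[ℝ] ℝ) × (E4 →L[ℝ] ℝ) × (E4 →L[ℝ] E4 →L[ℝ] ℝ) × E4)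
      (G₀ q.1 q.2, fderiv ℝ (f q.1) q.2, hessAt (G₀ q.1) (f q.1) q.2, e) < δA := by
    simp only [Prod.dist_eq, max_lt_iff]
    refine ⟨?_, hc3.trans_le (by linarith), hH, ?_⟩
    · calc dist (G q'.2) (G₀ q.1 q.2)
            ≤ dist (G q'.2) (G₀ q'.1 q'.2) + dist (G₀ q'.1 q'.2) (G₀ q.1 q.2) := dist_triangle _ _ _
        _ < δ + δ := add_lt_add_of_le_of_lt (by rwa [dist_eq_norm]) hc1
        _ ≤ δA := hδA'
    · rw [dist_eq_norm]
      linarith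
  obtain ⟨μ, hμ, hall⟩ := hA _ hd
  exact ⟨μ, hμ, hall⟩

/-- **Stub (UP-1) of the line `photon-shell-pseudoconvexity` (crux `GapExhaustion`,
stmt-FinalStateConjecture-10808) — the uniform, `C¹`-stable multiplier form (Ionescu–Klainerman,
Invent. Math. 175 (2009), Definition 3.1, condition (po3)) of a constrained Hessian margin,
UNIFORMLY over a compact set of LABELLED base points.** Let the components `G₀ p x` and the
function `f p x` be jointly `C^∞` in `(p, x)` on an open neighbourhood of the compact set
`S ⊆ (ℝ × ℝ) × E4`, with `G₀ q.1 q.2` invertible on `S`, and suppose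
`hessAt (G₀ q.1) (f q.1) q.2 w w ≤ −m‖w‖²` (`m > 0`) for all `q ∈ S` and all `w` with
`G₀ q.1 q.2 w w = 0`, `d(f q.1)_{q.2}(w) = 0`, `G₀ q.1 q.2 e w = 0`. Then there are `δ, ε₁ > 0`
such that for every `q = (p, x) ∈ S`, every field of components `G` with `‖G x − G₀ p x‖ ≤ δ`,
`‖DG(x) − D(G₀ p)(x)‖ ≤ δ` and every `e'` with `‖e' − e‖ ≤ δ` there is `μ ∈ [−ε₁⁻¹, ε₁⁻¹]` with
`ε₁²‖w‖² ≤ μ G x w w − hessAt G (f p) x w w + ε₁⁻²((G x e' w)² + (d(f p)_x w)²)` for ALL `w` —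
the parametric twin of `stub_multiplierFormStable`. Locally by `stub_multiplierFormStableParam_local`
((A) + (B)), globally by induction over the compact `S`. [folklore] -/
theorem stub_multiplierFormStableParam :
    ∀ (G₀ : ℝ × ℝ → E4 → E4 →L[ℝ] E4 →L[ℝ] ℝ) (f : ℝ × ℝ → E4 → ℝ) (e : E4)
      (S : Set ((ℝ × ℝ) × E4)) (m : ℝ), IsCompact S → 0 < m →
      (∃ U : Set ((ℝ × ℝ) × E4), IsOpen U ∧ S ⊆ U ∧
        ContDiffOn ℝ ∞ (fun q : (ℝ × ℝ) × E4 => G₀ q.1 q.2) U ∧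
        ContDiffOn ℝ ∞ (fun q : (ℝ × ℝ) × E4 => f q.1 q.2) U) →
      (∀ q ∈ S, (G₀ q.1 q.2).IsInvertible) →
      (∀ q ∈ S, ∀ w : E4, G₀ q.1 q.2 w w = 0 → fderiv ℝ (f q.1) q.2 w = 0 → G₀ q.1 q.2 e w = 0 →
        hessAt (G₀ q.1) (f q.1) q.2 w w ≤ -m * ‖w‖ ^ 2) →
      ∃ (δ ε₁ : ℝ), 0 < δ ∧ 0 < ε₁ ∧ ∀ q ∈ S, ∀ (G : E4 → E4 →L[ℝ] E4 →L[ℝ] ℝ) (e' : E4),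
        ‖G q.2 - G₀ q.1 q.2‖ ≤ δ → ‖fderiv ℝ G q.2 - fderiv ℝ (G₀ q.1) q.2‖ ≤ δ → ‖e' - e‖ ≤ δ →
        ∃ μ : ℝ, |μ| ≤ ε₁⁻¹ ∧ ∀ w : E4,
          ε₁ ^ 2 * ‖w‖ ^ 2 ≤ μ * G q.2 w w - hessAt G (f q.1) q.2 w w
            + ε₁⁻¹ ^ 2 * ((G q.2 e' w) ^ 2 + (fderiv ℝ (f q.1) q.2 w) ^ 2) := by
  intro G₀ f e S m hS hm hU hinv hmargin
  obtain ⟨U, hU, hSU, hG₀, hf⟩ := hU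
  -- induction over the compact `S`
  refine hS.induction_on (p := fun A => ∃ (δ ε₁ : ℝ), 0 < δ ∧ 0 < ε₁ ∧ ∀ q ∈ A,
      ∀ (G : E4 → E4 →L[ℝ] E4 →L[ℝ] ℝ) (e' : E4),
        ‖G q.2 - G₀ q.1 q.2‖ ≤ δ → ‖fderiv ℝ G q.2 - fderiv ℝ (G₀ q.1) q.2‖ ≤ δ → ‖e' - e‖ ≤ δ →
        ∃ μ : ℝ, |μ| ≤ ε₁⁻¹ ∧ ∀ w : E4,
          ε₁ ^ 2 * ‖w‖ ^ 2 ≤ μ * G q.2 w w - hessAt G (f q.1) q.2 w w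
            + ε₁⁻¹ ^ 2 * ((G q.2 e' w) ^ 2 + (fderiv ℝ (f q.1) q.2 w) ^ 2)) ?_ ?_ ?_ ?_
  · exact ⟨1, 1, one_pos, one_pos, fun q hq => (notMem_empty q hq).elim⟩
  · rintro A B hAB ⟨δ, ε₁, hδ, hε₁, h⟩
    exact ⟨δ, ε₁, hδ, hε₁, fun q hq => h q (hAB hq)⟩
  · rintro A B ⟨δ₁, ε₁, hδ₁, hε₁, h₁⟩ ⟨δ₂, ε₂, hδ₂, hε₂, h₂⟩
    refine ⟨min δ₁ δ₂, min ε₁ ε₂, lt_min hδ₁ hδ₂, lt_min hε₁ hε₂,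
      fun q hq G e' hG hdG he => ?_⟩
    rcases hq with hq | hq
    · exact stub_multiplierFormStableParam_mono (h₁ q hq G e' (hG.trans (min_le_left _ _))
        (hdG.trans (min_le_left _ _)) (he.trans (min_le_left _ _))) (lt_min hε₁ hε₂)
        (min_le_left _ _)
    · exact stub_multiplierFormStableParam_mono (h₂ q hq G e' (hG.trans (min_le_right _ _))
        (hdG.trans (min_le_right _ _)) (he.trans (min_le_right _ _))) (lt_min hε₁ hε₂)
        (min_le_right _ _)
  · intro q hq
    obtain ⟨t, ht, δ, ε₁, hδ, hε₁, h⟩ := stub_multiplierFormStableParam_local hU hG₀ hf hm (hSU hq)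
      (hinv q hq) (hmargin q hq)
    exact ⟨t, mem_nhdsWithin_of_mem_nhds ht, δ, ε₁, hδ, hε₁, h⟩

end Summit.FinalStateConjecture.FinalStateConjecture.Theorems

end
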